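import Literature.MathematicalPhysics.QuantumFieldTheory.Balaban1983to89.B10Eq47Volume
import Literature.MathematicalPhysics.QuantumFieldTheory.Balaban1983to89.GaussianSmallFieldSidak
import HarnessLib

/-!
# `Balaban1983to89.B10Eq47VolumeSidak` — T. Bałaban, *Ultraviolet stability of three-dimensional lattice pure gauge
field theories*, Commun. Math. Phys. **102** (1985) 255–275 [Balaban1985UV3]: the small-field Gaussian volume
factor of the lower bounds (37) p. 265 / (47) p. 267, NOW UNCONDITIONAL (Šidák's inequality discharged)

statement-level skeleton of published theorems with citation tags; proofs where landed; nothing here is a claim about the Yang–Mills mass gap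

PDF held: `paper:balaban1985-cmp102-uv-stability-3d` (journal page = PDF page + 254).

WHAT IS REPRODUCED.  The six small-field volume theorems of `…Balaban1983to89.B10Eq47Volume` (rows B10.Eq22 / B10.Eq37 /
B10.Eq47 of the `lit-balaban` SKELETON cite that module: *"χ = Π_{b∈B(Λ_{k+1})} χ({|A(b)| < g_kp²(g_k)}), g_k
sufficiently small"* (51) p. 268, the restrictions of (18) p. 260 / (37) p. 265 / (47) p. 267) and the box bound
`T4TerritoryReflection.smallFieldBox_real_ge`, each carried until now the ONE cited hypothesis
`hSidak : T4TerritoryReflection.SidakInequality` (= `GaussianSmallField.SidakInequality`, an `abbrev`).  That fact is a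
THEOREM since `GaussianSmallFieldSidak.sidakInequality_holds` (Šidák 1967 Cor. 1, proved in
`Literature.Probability.Distributions.KhatriSidak` along Giné–Nickl §2.4.1); this file restates the seven conclusions
WITHOUT the hypothesis, each proof being the original theorem applied to `sidakInequality_holds`.  Nothing of
`B10Eq47Volume` is modified or re-declared (new names in a new namespace; the originals keep their binder).  No
definition, no named fact, no `sorry`; axioms standard.  Unit `lit-balaban-p24` (gen 5, EXT:Sidak1967), HOME
`run/shared/lean/pub/lit-balaban/`.
-/

noncomputable section

open MeasureTheory ProbabilityTheory

namespace Literature.MathematicalPhysics.QuantumFieldTheory.Balaban1983to89.B10Eq47VolumeSidak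

open Literature.MathematicalPhysics.QuantumFieldTheory.Balaban1983to89
open Literature.MathematicalPhysics.QuantumFieldTheory.Balaban1983to89.B10Eq47Volume

/-- **THE SMALL-FIELD MASS OF A BOX, UNCONDITIONALLY** (`T4TerritoryReflection.smallFieldBox_real_ge` with Šidák
discharged): for a positive semidefinite covariance `S` on `k` sites with `S i i ≤ C`, `p > 0`, `2e^{−p²/(2C)} ≤ ½`:
`exp(−4e^{−p²/(2C)}·k) ≤ P_{N(0,S)}(|xᵢ| ≤ p ∀ i)`. [cite: Sidak1967, Corollary 1] -/
theorem smallFieldBox_real_ge {k : ℕ} {S : Matrix (Fin k) (Fin k) ℝ} (hS : S.PosSemidef)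
    {C p : ℝ} (hC : 0 < C) (hSC : ∀ i, S i i ≤ C) (hp : 0 < p)
    (hsmall : 2 * Real.exp (-(p ^ 2 / (2 * C))) ≤ 1 / 2) :
    Real.exp (-(4 * Real.exp (-(p ^ 2 / (2 * C))) * k)) ≤ (multivariateGaussian 0 S).real {x | ∀ i, |x i| ≤ p} :=
  T4TerritoryReflection.smallFieldBox_real_ge GaussianSmallFieldSidak.sidakInequality_holds hS hC hSC hp hsmall

/-- **THE SMALL-FIELD VOLUME, UNCONDITIONALLY** (`B10Eq47Volume.ballEvent_real_ge` with Šidák discharged):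
`exp(−4e^{−q²/(2C)}·N) ≤ P_{N(0,S)}(|A(b)| < r ∀ b)` for blocks of `≤ d` coordinates, `d·q² < r²`, `2e^{−q²/(2C)} ≤ ½`.
[cite: Balaban1985UV3, (47) p.267] -/
theorem ballEvent_real_ge {N : ℕ} {S : Matrix (Fin N) (Fin N) ℝ}
    (hS : S.PosSemidef) {C q r : ℝ} (hC : 0 < C) (hSC : ∀ i, S i i ≤ C) (hq : 0 < q) (hr : 0 < r)
    {β : Type*} (fib : β → Finset (Fin N)) {d : ℕ} (hd : ∀ b, (fib b).card ≤ d)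
    (hqr : (d : ℝ) * q ^ 2 < r ^ 2) (hsmall : 2 * Real.exp (-(q ^ 2 / (2 * C))) ≤ 1 / 2) :
    Real.exp (-(4 * Real.exp (-(q ^ 2 / (2 * C))) * N)) ≤ (multivariateGaussian 0 S).real (ballEvent fib r) :=
  B10Eq47Volume.ballEvent_real_ge GaussianSmallFieldSidak.sidakInequality_holds hS hC hSC hq hr fib hd hqr hsmall

/-- **The volume with a prescribed per-coordinate rate, unconditionally** (`B10Eq47Volume.ballEvent_real_ge_of_rate`
with Šidák discharged). [cite: Balaban1985UV3, (47) p.267] -/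
theorem ballEvent_real_ge_of_rate {N : ℕ}
    {S : Matrix (Fin N) (Fin N) ℝ} (hS : S.PosSemidef) {C r τ : ℝ} (hC : 0 < C) (hSC : ∀ i, S i i ≤ C) (hr : 0 < r)
    {β : Type*} (fib : β → Finset (Fin N)) {d : ℕ} (hd0 : 0 < d) (hd : ∀ b, (fib b).card ≤ d)
    (hτ : Real.exp (-(r ^ 2 / (4 * d * C))) ≤ τ) (hsmall : 2 * Real.exp (-(r ^ 2 / (4 * d * C))) ≤ 1 / 2) :
    Real.exp (-(4 * τ * N)) ≤ (multivariateGaussian 0 S).real (ballEvent fib r) :=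
  B10Eq47Volume.ballEvent_real_ge_of_rate GaussianSmallFieldSidak.sidakInequality_holds hS hC hSC hr fib hd0 hd hτ
    hsmall

/-- **THE VOLUME FACTOR OF (37)/(47), cutoff p²(g_k), UNCONDITIONALLY** (`B10Eq47Volume.volume47_real_ge` with Šidák
discharged): under the clause `4d(𝔤)σ²(6 + 2κ₀) ≤ b₀⁴(1 + log g⁻¹)^{4p₀−1}` at the bare coupling,
`exp(−4(Lᵏε)^{3+κ₀}·N) ≤ μ_{N(0,S)}(∩_b {|A(b)| < p²(g_k)})`, uniformly in k and ε.
[cite: Balaban1985UV3, (37) p.265 + (47) p.267] -/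
theorem volume47_real_ge {N : ℕ} {S : Matrix (Fin N) (Fin N) ℝ}
    (hS : S.PosSemidef) {σ2 : ℝ} (hσ : 0 < σ2) (hSσ : ∀ i, S i i ≤ σ2)
    {β : Type*} (fib : β → Finset (Fin N)) {dG : ℕ} (hdG : 0 < dG) (hfib : ∀ b, (fib b).card ≤ dG)
    {b₀ p₀ g L ε κ₀ : ℝ} {k : ℕ} (hb : 0 < b₀) (hp₀ : 1 ≤ p₀) (hg : 0 < g) (hg1 : g ≤ 1) (hL : 0 < L)
    (hε : 0 < ε) (ht1 : L ^ k * ε ≤ 1) (hκ : 0 ≤ κ₀)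
    (hγ : Clause (b₀ ^ 4) (4 * p₀) (4 * dG * σ2) (6 + 2 * κ₀) g) :
    Real.exp (-(4 * (L ^ k * ε) ^ (3 + κ₀) * N)) ≤
      (multivariateGaussian 0 S).real (ballEvent fib (B10.pFun b₀ p₀ (B10.gRun g L ε k) ^ 2)) :=
  B10Eq47Volume.volume47_real_ge GaussianSmallFieldSidak.sidakInequality_holds hS hσ hSσ fib hdG hfib hb hp₀ hg hg1
    hL hε ht1 hκ hγ

/-- **The same as an additive term in the exponent, unconditionally** (`B10Eq47Volume.log_volume47_ge` with Šidák
discharged): `−4(Lᵏε)^{3+κ₀}·N ≤ log μ_{N(0,S)}(∩_b {|A(b)| < p²(g_k)})`. [cite: Balaban1985UV3, (47) p.267] -/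
theorem log_volume47_ge {N : ℕ} {S : Matrix (Fin N) (Fin N) ℝ}
    (hS : S.PosSemidef) {σ2 : ℝ} (hσ : 0 < σ2) (hSσ : ∀ i, S i i ≤ σ2)
    {β : Type*} (fib : β → Finset (Fin N)) {dG : ℕ} (hdG : 0 < dG) (hfib : ∀ b, (fib b).card ≤ dG)
    {b₀ p₀ g L ε κ₀ : ℝ} {k : ℕ} (hb : 0 < b₀) (hp₀ : 1 ≤ p₀) (hg : 0 < g) (hg1 : g ≤ 1) (hL : 0 < L)
    (hε : 0 < ε) (ht1 : L ^ k * ε ≤ 1) (hκ : 0 ≤ κ₀)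
    (hγ : Clause (b₀ ^ 4) (4 * p₀) (4 * dG * σ2) (6 + 2 * κ₀) g) :
    -(4 * (L ^ k * ε) ^ (3 + κ₀) * N) ≤
      Real.log ((multivariateGaussian 0 S).real (ballEvent fib (B10.pFun b₀ p₀ (B10.gRun g L ε k) ^ 2))) :=
  B10Eq47Volume.log_volume47_ge GaussianSmallFieldSidak.sidakInequality_holds hS hσ hSσ fib hdG hfib hb hp₀ hg hg1
    hL hε ht1 hκ hγ

/-- **The printed shape `−O((Lᵏε)^{3+κ₀})|T₁^{(k)}|`, unconditionally** (`B10Eq47Volume.volume47_real_ge_sites` with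
Šidák discharged): with `N ≤ c_B·|T₁^{(k)}|` real coordinates, the printed O(1) of the j = k remainder summand of (47)
may be taken `= 4c_B`, independent of k, ε, L. [cite: Balaban1985UV3, (47) p.267] -/
theorem volume47_real_ge_sites {N : ℕ}
    {S : Matrix (Fin N) (Fin N) ℝ} (hS : S.PosSemidef) {σ2 : ℝ} (hσ : 0 < σ2) (hSσ : ∀ i, S i i ≤ σ2)
    {β : Type*} (fib : β → Finset (Fin N)) {dG : ℕ} (hdG : 0 < dG) (hfib : ∀ b, (fib b).card ≤ dG)
    {b₀ p₀ g L ε κ₀ Tε cB : ℝ} {k : ℕ} (hb : 0 < b₀) (hp₀ : 1 ≤ p₀) (hg : 0 < g) (hg1 : g ≤ 1) (hL : 0 < L)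
    (hε : 0 < ε) (ht1 : L ^ k * ε ≤ 1) (hκ : 0 ≤ κ₀)
    (hγ : Clause (b₀ ^ 4) (4 * p₀) (4 * dG * σ2) (6 + 2 * κ₀) g) (hN : (N : ℝ) ≤ cB * B10.sitesRun L ε Tε k) :
    Real.exp (-(4 * cB * (L ^ k * ε) ^ (3 + κ₀) * B10.sitesRun L ε Tε k)) ≤
      (multivariateGaussian 0 S).real (ballEvent fib (B10.pFun b₀ p₀ (B10.gRun g L ε k) ^ 2)) :=
  B10Eq47Volume.volume47_real_ge_sites GaussianSmallFieldSidak.sidakInequality_holds hS hσ hSσ fib hdG hfib hb hp₀ hg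
    hg1 hL hε ht1 hκ hγ hN

/-- **THE VOLUME FACTOR FOR THE CUTOFF `c₁p(g_k)`, UNCONDITIONALLY** (`B10Eq47Volume.volumeLinear_real_ge` with Šidák
discharged): under the clause `4d(𝔤)σ²(6 + 2κ₀) ≤ c₁²b₀²(1 + log g⁻¹)^{2p₀−1}`,
`exp(−4(Lᵏε)^{3+κ₀}·N) ≤ μ_{N(0,S)}(∩_b {|A(b)| < c₁p(g_k)})`. [cite: Balaban1985UV3, (37) p.265] -/
theorem volumeLinear_real_ge {N : ℕ}
    {S : Matrix (Fin N) (Fin N) ℝ} (hS : S.PosSemidef) {σ2 : ℝ} (hσ : 0 < σ2) (hSσ : ∀ i, S i i ≤ σ2)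
    {β : Type*} (fib : β → Finset (Fin N)) {dG : ℕ} (hdG : 0 < dG) (hfib : ∀ b, (fib b).card ≤ dG)
    {b₀ p₀ g L ε κ₀ c₁ : ℝ} {k : ℕ} (hb : 0 < b₀) (hp₀ : 1 ≤ p₀) (hg : 0 < g) (hg1 : g ≤ 1) (hL : 0 < L)
    (hε : 0 < ε) (ht1 : L ^ k * ε ≤ 1) (hκ : 0 ≤ κ₀) (hc₁ : 0 < c₁)
    (hγ : Clause (c₁ ^ 2 * b₀ ^ 2) (2 * p₀) (4 * dG * σ2) (6 + 2 * κ₀) g) :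
    Real.exp (-(4 * (L ^ k * ε) ^ (3 + κ₀) * N)) ≤
      (multivariateGaussian 0 S).real (ballEvent fib (c₁ * B10.pFun b₀ p₀ (B10.gRun g L ε k))) :=
  B10Eq47Volume.volumeLinear_real_ge GaussianSmallFieldSidak.sidakInequality_holds hS hσ hSσ fib hdG hfib hb hp₀ hg
    hg1 hL hε ht1 hκ hc₁ hγ

end Literature.MathematicalPhysics.QuantumFieldTheory.Balaban1983to89.B10Eq47VolumeSidak
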